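import Literature.NumberTheory.EllipticCurves.CongruenceVisibilityMultiplicativeTwisted
import HarnessLib

/-!
# The twisted Tate comparison of local Kummer conditions, DATA form (cell `b2b-bsdres`, team n1011,
# row T-VIS3-TATE; seat p09 GEN 11; FILE M1)

HONEST FRAMING (cell `b2b-bsdres`, run/shared/lean/b2b/bsd-rank1-residual/, verbatim in every
file): the goal of the cell is to DELETE the COMBINATION-SHAPED residual classes of the
Birch–Swinnerton-Dyer formula for ALL analytic-rank `≤ 1` elliptic curves over `ℚ` — "full BSD
formula for every rank `≤ 1` curve in class `C`" assembled STRICTLY from published theorems — so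
that the rank-`≤ 1` remainder becomes exactly the CONSTRUCTION-SHAPED classes, which are TYPED
(missing-input `Prop`s), NOT attempted. This is not "finishing BSD". Team n1011 (N10 / N11, the
additive block X4 ∧ `p = 3`): research route on the CONSTRUCTION-SHAPED class X4; no claim beyond
the stated classes; nothing is booked; no mark / label / count is changed by this file. ONE theorem
(no definition, no named fact — not even as a hypothesis — no `sorry`); general (any number field,
any odd prime `p`, any finite place `v`, `v ∣ p` allowed) and cell-independent; closes NO class.

`TwistedKummer.h1Equiv_mem_selmerLocalKer_of_twistedUniformisationAt`: the tree's kind (iii)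
theorem `WeierstrassCurve.h1Equiv_mem_selmerLocalKer_of_hasMultiplicativeReductionAt`
(`Literature/NumberTheory/EllipticCurves/CongruenceVisibilityMultiplicativeTwisted.lean`, x11a)
uses "`E`, `E'` multiplicative at `v`" at exactly two lines — the two calls of the named fact
`Silverman1994_thmV53_corV54_tateUniformisation` (Silverman, *ATAEC* V, Lemma 5.2 (c), Thm. 5.3,
Cor. 5.4). Here that proof is re-run VERBATIM with the two calls replaced by DATA binders `hUW`,
`hUW'` = the fact's conclusion for `E` at `v` and for `E'` at `v`, spelled out (`q ∈ K_v^×`,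
`|q|_v < 1`; `t² = γ = -c₄/c₆`; `Ψ : K̄_v^× ↠ E(K̄_v)` with kernel `q^ℤ`, twisted-equivariant
`σ • Ψ(u) = χ(σ) Ψ(σu)`, `χ(σ) = σ(t)/t`; `K_v`-points = `Ψ(u)`, `u ∈ K_v(t)` of norm in `q^ℤ`,
Cor. V.5.4). Any producer of such data at ONE place — the registered fact at a multiplicative place
(kind (iii)), its PRINTED general form "`|j(E)|_v > 1`" (Thm. V.5.3's hypothesis; kind (iii′) at an
additive place of potentially multiplicative reduction — FILE M2 of this row), or a future proof —
then gives, for `p` odd, `θ : E'[p] ⥲ E[p]` `Γ_K`-equivariant, `γ(E) = r² γ(E')` in `K_v` and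
`μ_p(K_v) = 1`: `θ_* 𝓢_v(E') ≤ 𝓢_v(E)` (`ι_v(θ) = 1`; `relIndex` form in FILE M2).

References: [SilvermanATAEC1994] Ch. V 5.2–5.4; [CremonaMazur2000] §3; [MazurRubin2004] §2.3.
-/

noncomputable section

open scoped Classical
open Field NumberField IsDedekindDomain WeierstrassCurve
open Literature.NumberTheory.EllipticCurves Literature.NumberTheory.GaloisRepresentations

namespace Summit.BirchSwinnertonDyer.Rank1Residual.GaloisImage

namespace TwistedKummer

variable {K : Type} [Field K] [NumberField K] (W : WeierstrassCurve K) [W.IsElliptic]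
  {p : ℕ} [hp : Fact p.Prime] (v : HeightOneSpectrum (𝓞 K))
set_option maxHeartbeats 400000 in -- buildfix (bf3-g25): 160k/180k FAIL, 200k PASS at accept time; line-neutral budget line
/-- **The local Kummer conditions of two `p`-congruent curves agree at a place where both admit a
twisted Tate uniformisation of the same twist class, when `μ_p(K_v) = 1` — DATA form.** `E = W`,
`E' = W'` elliptic curves over a number field `K`, `p` an odd prime, `θ : E'[p] ⥲ E[p]` a
`Γ_K`-isomorphism, `v` a finite place (any residue characteristic); `hUW`, `hUW'` = the data of
Silverman *ATAEC* V.5.3 / Cor. V.5.4 for `E` and `E'` at `v` (`q ≠ 0`, `|q|_v < 1`; `t ≠ 0`,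
`t² = -c₄/c₆`; `Ψ` surjective, kernel `q^ℤ`, `σ • Ψ(u) = ± Ψ(σu)` as `σ t = t` or not; rational
points `Ψ(u)`, `u` fixed by the `σ` fixing `t`, `u σ(u) ∈ q^ℤ` for the `σ` moving `t`);
`γ(E) = r² γ(E')` in `K_v`; `μ_p(K_v) = 1`. Then every class of `H¹(K, E'[p])` locally trivial at
`v` for `E'` is carried by `θ` to a class locally trivial at `v` for `E` (`θ_* 𝓢_v(E') ≤ 𝓢_v(E)`).
= x11a's `WeierstrassCurve.h1Equiv_mem_selmerLocalKer_of_hasMultiplicativeReductionAt` with its two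
calls of the named fact replaced by `hUW`, `hUW'`; the proof is that proof verbatim (replace `a'`
by `(p+1)a'`, lift `p(p+1)a' = Ψ'(u')` with `u'` twist-invariant, `p`-th root `w`, twisted
dichotomy on the line `Ψ'(μ_p)`; "`Γ_{K_v}` fixes `ζ_p`" contradicts `μ_p(K_v) = 1`).
[cite: SilvermanATAEC1994, Ch. V Lemma 5.2 (c), Thm. 5.3, Cor. 5.4] [cite: CremonaMazur2000, §3] -/
theorem h1Equiv_mem_selmerLocalKer_of_twistedUniformisationAt (hp2 : p ≠ 2)
    (W' : WeierstrassCurve K) [W'.IsElliptic]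
    (θ : geomTorsion W' (p : ℤ) ≃+ geomTorsion W (p : ℤ))
    (hθ : ∀ (σ : absoluteGaloisGroup K) (P : geomTorsion W' (p : ℤ)), θ (σ • P) = σ • θ P)
    (hUW : (∃ (q : v.adicCompletion K) (t : AlgebraicClosure (v.adicCompletion K))
      (Ψ : Additive (AlgebraicClosure (v.adicCompletion K))ˣ →+ localPoints W (v.adicCompletion K)),
      q ≠ 0 ∧ Valued.v q < 1 ∧ t ≠ 0 ∧ t ^ 2 = algebraMap (v.adicCompletion K)
        (AlgebraicClosure (v.adicCompletion K)) (algebraMap K (v.adicCompletion K) (-(W.c₄ / W.c₆))) ∧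
      Function.Surjective Ψ ∧
      (∀ u : (AlgebraicClosure (v.adicCompletion K))ˣ, Ψ (Additive.ofMul u) = 0 ↔
        ∃ n : ℤ, (u : AlgebraicClosure (v.adicCompletion K)) =
          algebraMap (v.adicCompletion K) (AlgebraicClosure (v.adicCompletion K)) q ^ n) ∧
      (∀ (σ : absoluteGaloisGroup (v.adicCompletion K))
          (u : (AlgebraicClosure (v.adicCompletion K))ˣ),
        σ • Ψ (Additive.ofMul u) =
          (if Field.absoluteGaloisGroup.toAlgEquiv (v.adicCompletion K) σ t = t then (1 : ℤ)
            else -1) •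
          Ψ (Additive.ofMul (Units.map
            (Field.absoluteGaloisGroup.toAlgEquiv (v.adicCompletion K) σ :
              AlgebraicClosure (v.adicCompletion K) →* AlgebraicClosure (v.adicCompletion K))
            u))) ∧
      (∀ P : localPoints W (v.adicCompletion K),
        (∀ σ : absoluteGaloisGroup (v.adicCompletion K), σ • P = P) →
        ∃ u : (AlgebraicClosure (v.adicCompletion K))ˣ,
          (∀ σ : absoluteGaloisGroup (v.adicCompletion K),
            Field.absoluteGaloisGroup.toAlgEquiv (v.adicCompletion K) σ t = t →
            Units.map (Field.absoluteGaloisGroup.toAlgEquiv (v.adicCompletion K) σ :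
              AlgebraicClosure (v.adicCompletion K) →* AlgebraicClosure (v.adicCompletion K)) u = u) ∧
          (∀ σ : absoluteGaloisGroup (v.adicCompletion K),
            Field.absoluteGaloisGroup.toAlgEquiv (v.adicCompletion K) σ t ≠ t →
            ∃ m : ℤ, ((u * Units.map
              (Field.absoluteGaloisGroup.toAlgEquiv (v.adicCompletion K) σ :
                AlgebraicClosure (v.adicCompletion K) →* AlgebraicClosure (v.adicCompletion K))
              u : (AlgebraicClosure (v.adicCompletion K))ˣ) : AlgebraicClosure (v.adicCompletion K)) =
              algebraMap (v.adicCompletion K) (AlgebraicClosure (v.adicCompletion K)) q ^ m) ∧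
          Ψ (Additive.ofMul u) = P)))
    (hUW' : (∃ (q : v.adicCompletion K) (t : AlgebraicClosure (v.adicCompletion K))
      (Ψ : Additive (AlgebraicClosure (v.adicCompletion K))ˣ →+ localPoints W' (v.adicCompletion K)),
      q ≠ 0 ∧ Valued.v q < 1 ∧ t ≠ 0 ∧ t ^ 2 = algebraMap (v.adicCompletion K)
        (AlgebraicClosure (v.adicCompletion K)) (algebraMap K (v.adicCompletion K) (-(W'.c₄ / W'.c₆))) ∧
      Function.Surjective Ψ ∧
      (∀ u : (AlgebraicClosure (v.adicCompletion K))ˣ, Ψ (Additive.ofMul u) = 0 ↔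
        ∃ n : ℤ, (u : AlgebraicClosure (v.adicCompletion K)) =
          algebraMap (v.adicCompletion K) (AlgebraicClosure (v.adicCompletion K)) q ^ n) ∧
      (∀ (σ : absoluteGaloisGroup (v.adicCompletion K))
          (u : (AlgebraicClosure (v.adicCompletion K))ˣ),
        σ • Ψ (Additive.ofMul u) =
          (if Field.absoluteGaloisGroup.toAlgEquiv (v.adicCompletion K) σ t = t then (1 : ℤ)
            else -1) •
          Ψ (Additive.ofMul (Units.map
            (Field.absoluteGaloisGroup.toAlgEquiv (v.adicCompletion K) σ :
              AlgebraicClosure (v.adicCompletion K) →* AlgebraicClosure (v.adicCompletion K))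
            u))) ∧
      (∀ P : localPoints W' (v.adicCompletion K),
        (∀ σ : absoluteGaloisGroup (v.adicCompletion K), σ • P = P) →
        ∃ u : (AlgebraicClosure (v.adicCompletion K))ˣ,
          (∀ σ : absoluteGaloisGroup (v.adicCompletion K),
            Field.absoluteGaloisGroup.toAlgEquiv (v.adicCompletion K) σ t = t →
            Units.map (Field.absoluteGaloisGroup.toAlgEquiv (v.adicCompletion K) σ :
              AlgebraicClosure (v.adicCompletion K) →* AlgebraicClosure (v.adicCompletion K)) u = u) ∧
          (∀ σ : absoluteGaloisGroup (v.adicCompletion K),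
            Field.absoluteGaloisGroup.toAlgEquiv (v.adicCompletion K) σ t ≠ t →
            ∃ m : ℤ, ((u * Units.map
              (Field.absoluteGaloisGroup.toAlgEquiv (v.adicCompletion K) σ :
                AlgebraicClosure (v.adicCompletion K) →* AlgebraicClosure (v.adicCompletion K))
              u : (AlgebraicClosure (v.adicCompletion K))ˣ) : AlgebraicClosure (v.adicCompletion K)) =
              algebraMap (v.adicCompletion K) (AlgebraicClosure (v.adicCompletion K)) q ^ m) ∧
          Ψ (Additive.ofMul u) = P)))
    (hγ : ∃ r : (v.adicCompletion K), algebraMap K (v.adicCompletion K) (-(W.c₄ / W.c₆))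
        = r ^ 2 * algebraMap K (v.adicCompletion K) (-(W'.c₄ / W'.c₆)))
    (hμ : ∀ ζ : (v.adicCompletion K), ζ ^ p = 1 → ζ = 1)
    {c : galH1Torsion W' (p : ℤ)} (hc : c ∈ selmerLocalKer W' (v.adicCompletion K) (p : ℤ)) :
    h1Equiv θ hθ c ∈ selmerLocalKer W (v.adicCompletion K) (p : ℤ) := by
  have hpp : p.Prime := hp.out
  haveI : NeZero p := ⟨hpp.ne_zero⟩
  haveI : CharZero (v.adicCompletion K) := charZero_adicCompletion v
  haveI : CharZero (AlgebraicClosure (v.adicCompletion K)) := charZero_of_injective_algebraMap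
      (algebraMap (v.adicCompletion K) (AlgebraicClosure (v.adicCompletion K))).injective
  have hn : (p : ℤ) ≠ 0 := by exact_mod_cast hpp.ne_zero
  obtain ⟨k₂, hk₂⟩ : ∃ k₂ : ℕ, p + 1 = 2 * k₂ := by
    obtain ⟨k, hk⟩ := hpp.odd_of_ne_two hp2
    exact ⟨k + 1, by omega⟩
  -- twisted Tate parametrisations of `E` and `E'` at `v`
  obtain ⟨q, t, Φ, hq0, hq1, ht0, ht2, -, hker, hequiv₀, -⟩ := hUW
  obtain ⟨q', t', Φ', hq0', hq1', ht0', ht2', -, hker', hequiv₀', hrat'⟩ := hUW'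
  -- the two quadratic characters coincide (`t = ± r t'`)
  obtain ⟨r, hr⟩ := hγ
  have htt' : t = algebraMap (v.adicCompletion K) (AlgebraicClosure
      (v.adicCompletion K)) r * t' ∨ t = -(algebraMap (v.adicCompletion K) (AlgebraicClosure
      (v.adicCompletion K)) r * t') := by
    have h : t ^ 2 = (algebraMap (v.adicCompletion K) (AlgebraicClosure
        (v.adicCompletion K)) r * t') ^ 2 := by
      rw [ht2, hr, map_mul, map_pow, mul_pow, ht2']
    exact sq_eq_sq_iff_eq_or_eq_neg.mp h
  have hr0 : algebraMap (v.adicCompletion K) (AlgebraicClosure (v.adicCompletion K)) r ≠ 0 := by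
    intro h0
    rw [h0, zero_mul, neg_zero, or_self] at htt'
    exact ht0 htt'
  have hfixiff : ∀ σ : (absoluteGaloisGroup (v.adicCompletion K)),
      Field.absoluteGaloisGroup.toAlgEquiv (v.adicCompletion K) σ t = t ↔
        Field.absoluteGaloisGroup.toAlgEquiv (v.adicCompletion K) σ t' = t' := by
    intro σ
    rcases htt' with h | h
    · constructor
      · intro e
        rw [h, map_mul, AlgEquiv.commutes] at e
        exact mul_left_cancel₀ hr0 e
      · intro e
        rw [h, map_mul, AlgEquiv.commutes, e]
    · constructor
      · intro e
        rw [h, map_neg, map_mul, AlgEquiv.commutes, neg_inj] at e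
        exact mul_left_cancel₀ hr0 e
      · intro e
        rw [h, map_neg, map_mul, AlgEquiv.commutes, e]
  -- the common sign `ε(σ) = χ(σ)`
  obtain ⟨ε, hε_of_fix, hε_of_not⟩ : ∃ ε : (absoluteGaloisGroup (v.adicCompletion K)) → ℤ,
      (∀ σ, Field.absoluteGaloisGroup.toAlgEquiv (v.adicCompletion K) σ t' = t' → ε σ = 1) ∧
        (∀ σ, Field.absoluteGaloisGroup.toAlgEquiv (v.adicCompletion K) σ t' ≠ t' → ε σ = -1) :=
    ⟨fun σ ↦ if Field.absoluteGaloisGroup.toAlgEquiv (v.adicCompletion K) σ t' = t' then 1 else -1,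
      fun σ h ↦ if_pos h, fun σ h ↦ if_neg h⟩
  have hε : ∀ σ, ε σ = 1 ∨ ε σ = -1 := fun σ ↦ by
    by_cases h : Field.absoluteGaloisGroup.toAlgEquiv (v.adicCompletion K) σ t' = t'
    · exact Or.inl (hε_of_fix σ h)
    · exact Or.inr (hε_of_not σ h)
  have hequiv : ∀ (σ : (absoluteGaloisGroup (v.adicCompletion K))) (u : (AlgebraicClosure
      (v.adicCompletion K))ˣ),
      σ • Φ (Additive.ofMul u) = Φ (Additive.ofMul ((Units.map
          (absoluteGaloisGroup.toAlgEquiv _ σ : AlgebraicClosure (v.adicCompletion K)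
          →* AlgebraicClosure (v.adicCompletion K)) u) ^ (ε σ))) := by
    intro σ u
    rw [hequiv₀ σ u, ofMul_zpow, map_zsmul]
    by_cases h : Field.absoluteGaloisGroup.toAlgEquiv (v.adicCompletion K) σ t' = t'
    · rw [if_pos ((hfixiff σ).mpr h), hε_of_fix σ h]
    · rw [if_neg (fun h' ↦ h ((hfixiff σ).mp h')), hε_of_not σ h]
  have hequiv' : ∀ (σ : (absoluteGaloisGroup (v.adicCompletion K))) (u : (AlgebraicClosure
      (v.adicCompletion K))ˣ),
      σ • Φ' (Additive.ofMul u) = Φ' (Additive.ofMul ((Units.map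
          (absoluteGaloisGroup.toAlgEquiv _ σ : AlgebraicClosure (v.adicCompletion K)
          →* AlgebraicClosure (v.adicCompletion K)) u) ^ (ε σ))) := by
    intro σ u
    rw [hequiv₀' σ u, ofMul_zpow, map_zsmul]
    by_cases h : Field.absoluteGaloisGroup.toAlgEquiv (v.adicCompletion K) σ t' = t'
    · rw [if_pos h, hε_of_fix σ h]
    · rw [if_neg h, hε_of_not σ h]
  -- the twisted action `u ↦ (σu)^{ε σ}` on `K̄_vˣ` is multiplicative and commutes with powers
  have hact_pow : ∀ (σ : (absoluteGaloisGroup (v.adicCompletion K))) (x : (AlgebraicClosure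
      (v.adicCompletion K))ˣ) (n : ℕ),
      (Units.map (absoluteGaloisGroup.toAlgEquiv _ σ : AlgebraicClosure (v.adicCompletion K)
          →* AlgebraicClosure (v.adicCompletion K)) (x ^ n)) ^ (ε σ) = ((Units.map
          (absoluteGaloisGroup.toAlgEquiv _ σ : AlgebraicClosure (v.adicCompletion K)
          →* AlgebraicClosure (v.adicCompletion K)) x) ^ (ε σ)) ^ n := by
    intro σ x n
    rw [map_pow, ← zpow_natCast, ← zpow_mul, mul_comm, zpow_mul, zpow_natCast]
  have hact_div : ∀ (σ : (absoluteGaloisGroup (v.adicCompletion K))) (x y : (AlgebraicClosure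
      (v.adicCompletion K))ˣ),
      (Units.map (absoluteGaloisGroup.toAlgEquiv _ σ : AlgebraicClosure (v.adicCompletion K)
          →* AlgebraicClosure (v.adicCompletion K)) (x / y)) ^ (ε σ) = (Units.map
          (absoluteGaloisGroup.toAlgEquiv _ σ : AlgebraicClosure (v.adicCompletion K)
          →* AlgebraicClosure (v.adicCompletion K)) x) ^ (ε σ) / (Units.map
          (absoluteGaloisGroup.toAlgEquiv _ σ : AlgebraicClosure (v.adicCompletion K)
          →* AlgebraicClosure (v.adicCompletion K)) y) ^ (ε σ) := by
    intro σ x y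
    rw [map_div, div_zpow]
  -- a primitive `p`-th root of unity `ζ₀ = Z`
  obtain ⟨ζ₀, hζ₀⟩ := HasEnoughRootsOfUnity.exists_primitiveRoot (AlgebraicClosure
      (v.adicCompletion K)) p
  have hZu : IsUnit ζ₀ := hζ₀.isUnit hpp.ne_zero
  set Z : (AlgebraicClosure (v.adicCompletion K))ˣ := hZu.unit with hZdef
  have hZ : IsPrimitiveRoot (Z : (AlgebraicClosure (v.adicCompletion K))) p := by
    rw [hZdef, IsUnit.unit_spec]; exact hζ₀
  have hZp : Z ^ p = 1 :=
    Units.ext (by rw [Units.val_pow_eq_pow_val, hZ.pow_eq_one, Units.val_one])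
  -- the torsion comparison `E'[p](K̄) ≃ E'(K̄_v)[p]` and the transport `G = pointsMap ∘ θ ∘ e'⁻¹`
  set e' := W'.torsionPointsEquiv (p : ℤ) (E := (v.adicCompletion K)) hn with he'
  set G : AddSubgroup.torsionBy (localPoints W' (v.adicCompletion K)) (p : ℤ) →+ localPoints W
      (v.adicCompletion K) :=
    ((pointsMap W (v.adicCompletion K)).comp (geomTorsion W (p : ℤ)).subtype).comp
      (θ.toAddMonoidHom.comp e'.symm.toAddMonoidHom) with hG
  have hG_apply : ∀ T, G T = pointsMap W (v.adicCompletion K) ((θ (e'.symm T) : geomTorsion W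
      (p : ℤ)) :
      geomPoints W) := fun T ↦ rfl
  have hGsmul : ∀ (σ : (absoluteGaloisGroup (v.adicCompletion K))) (T : AddSubgroup.torsionBy
      (localPoints W' (v.adicCompletion K)) (p : ℤ)),
      G (σ • T) = σ • G T := by
    intro σ T
    rw [hG_apply, hG_apply, he', torsionPointsEquiv_symm_smul, hθ,
      Literature.NumberTheory.EllipticCurves.AddSubgroup.torsionBy.coe_smul, pointsMap_smul]
  have hmem' : ∀ {ζ : (AlgebraicClosure (v.adicCompletion K))ˣ}, ζ ^ p = 1 →
      Φ' (Additive.ofMul ζ) ∈ AddSubgroup.torsionBy (localPoints W' (v.adicCompletion K)) (p : ℤ) :=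
    fun hζ ↦ (Submodule.mem_torsionBy_iff _ _).mpr
        (W'.zsmul_map_ofMul_eq_zero_of_pow_eq_one v Φ' hζ)
  set XZ : AddSubgroup.torsionBy (localPoints W' (v.adicCompletion K)) (p : ℤ) := ⟨Φ'
      (Additive.ofMul Z), hmem' hZp⟩
    with hXZ
  have hL₂p : (p : ℤ) • G XZ = 0 := by
    have h0 : (p : ℤ) • XZ = 0 := Subtype.ext (by
      rw [AddSubgroupClass.coe_zsmul, hXZ, AddSubgroup.coe_zero]
      exact W'.zsmul_map_ofMul_eq_zero_of_pow_eq_one v Φ' hZp)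
    rw [← map_zsmul, h0, map_zero]
  have hL₂σ : ∀ (σ : (absoluteGaloisGroup (v.adicCompletion K))) (c : ℕ), (Units.map
      (absoluteGaloisGroup.toAlgEquiv _ σ : AlgebraicClosure (v.adicCompletion K)
      →* AlgebraicClosure (v.adicCompletion K)) Z) ^ (ε σ) = Z ^ c →
      σ • G XZ = c • G XZ := by
    intro σ c hc
    have h1 : σ • XZ = c • XZ := Subtype.ext (by
      rw [Literature.NumberTheory.EllipticCurves.AddSubgroup.torsionBy.coe_smul,
        AddSubgroupClass.coe_nsmul, hXZ]
      change σ • Φ' (Additive.ofMul Z) = c • Φ' (Additive.ofMul Z)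
      rw [hequiv', hc, ofMul_pow, map_nsmul])
    rw [← hGsmul, h1, map_nsmul]
  -- the dichotomy; the second alternative contradicts `μ_p(K_v) = 1`
  rcases W.exists_eq_nsmul_or_forall_map_eq_self v hq0 hq1 Φ hker ε hε hequiv hZ hL₂p hL₂σ with
    ⟨a, ha⟩ | hfix
  swap
  · exact (false_of_forall_map_primitiveRoot_eq (K := K) v hμ hZ hfix).elim
  have hclaim : ∀ (ζ : (AlgebraicClosure (v.adicCompletion K))ˣ) (hζ : ζ ^ p = 1),
      G ⟨Φ' (Additive.ofMul ζ), hmem' hζ⟩ = Φ (Additive.ofMul (ζ ^ a)) := by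
    intro ζ hζ
    obtain ⟨k, -, hk⟩ := hZ.eq_pow_of_pow_eq_one (ξ := (ζ : (AlgebraicClosure
        (v.adicCompletion K))))
      (by rw [← Units.val_pow_eq_pow_val, hζ, Units.val_one])
    have hζk : ζ = Z ^ k := Units.ext (by rw [← hk, Units.val_pow_eq_pow_val])
    have hX : (⟨Φ' (Additive.ofMul ζ), hmem' hζ⟩ : AddSubgroup.torsionBy (localPoints W'
        (v.adicCompletion K)) (p : ℤ)) =
        k • XZ := Subtype.ext (by
      rw [AddSubgroupClass.coe_nsmul, hXZ]
      change Φ' (Additive.ofMul ζ) = k • Φ' (Additive.ofMul Z)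
      rw [hζk, ofMul_pow, map_nsmul])
    rw [hX, map_nsmul, ha, hζk, ← pow_mul, ofMul_pow, map_nsmul, mul_nsmul']
  -- the class `c` and a point `a'` trivialising it locally for `E'`; we use `a₁ = a' + p a'`
  obtain ⟨φ, rfl⟩ :=
    oneCocycleClass_surjective (discreteTopRep (absoluteGaloisGroup K) (geomTorsion W' (p : ℤ))) c
  rw [selmerLocalKer, oneCocycleClass_mem_resKer_iff] at hc
  obtain ⟨a', ha'⟩ := hc
  have ha'' : ∀ σ : (absoluteGaloisGroup (v.adicCompletion K)), pointsMap W' (v.adicCompletion K)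
      ((φ.1 (resGal (K := K) (v.adicCompletion K) σ) : geomTorsion W' (p : ℤ)) :
      geomPoints W') = σ • a' - a' := fun σ ↦ ha' σ
  have hP'fix : ∀ σ : (absoluteGaloisGroup (v.adicCompletion K)), σ • ((p : ℤ) • a') = (p : ℤ)
      • a' := by
    intro σ
    have h0 : (p : ℤ) • (σ • a' - a') = 0 := by
      rw [← ha'' σ, ← map_zsmul, (mem_geomTorsion_iff W' _ _).mp (φ.1 _).2, map_zero]
    rw [W'.smul_zsmul_localPoints (p : ℤ) σ a']
    rw [zsmul_sub, sub_eq_zero] at h0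
    exact h0
  set a₁ : localPoints W' (v.adicCompletion K) := a' + (p : ℤ) • a' with ha₁
  have ha₁' : ∀ σ : (absoluteGaloisGroup (v.adicCompletion K)), pointsMap W' (v.adicCompletion K)
      ((φ.1 (resGal (K := K) (v.adicCompletion K) σ) : geomTorsion W' (p : ℤ)) :
      geomPoints W') = σ • a₁ - a₁ := by
    intro σ
    rw [ha'' σ, ha₁, smul_add, hP'fix]
    abel
  have hpa₁ : (p : ℤ) • a₁ = (p + 1 : ℕ) • ((p : ℤ) • a') := by
    rw [ha₁, zsmul_add, succ_nsmul, ← natCast_zsmul ((p : ℤ) • a') p, add_comm]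
  -- `p a' = Ψ'(u)` with `u ∈ L`, `N(u) ∈ q'^ℤ` (Cor. V.5.4); an invariant `u'` with
  -- `Ψ'(u') = (p+1) p a'` (`exists_twistInvariant_lift`)
  obtain ⟨u, huL, huN, hu⟩ := hrat' ((p : ℤ) • a') hP'fix
  obtain ⟨u', hu'inv, hu'val⟩ := W'.exists_twistInvariant_lift v hq0' Φ' hker' ht2' ε hε_of_fix
    hε_of_not k₂ huL huN
  rw [hu, ← hk₂] at hu'val
  -- a `p`-th root `w` of `u'`, `R' = Φ'(w)` with `p R' = p a₁`, and `T = a₁ - R' ∈ E'[p]`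
  obtain ⟨z, hz⟩ := IsAlgClosed.exists_pow_nat_eq (u' : (AlgebraicClosure
      (v.adicCompletion K))) hpp.pos
  have hz0 : z ≠ 0 := by
    rintro rfl
    rw [zero_pow hpp.ne_zero] at hz
    exact u'.ne_zero hz.symm
  set w : (AlgebraicClosure (v.adicCompletion K))ˣ := Units.mk0 z hz0 with hw
  have hwp : w ^ p = u' := Units.ext (by rw [Units.val_pow_eq_pow_val, hw, Units.val_mk0, hz])
  set R' : localPoints W' (v.adicCompletion K) := Φ' (Additive.ofMul w) with hR'
  have hR'p : (p : ℤ) • R' = (p : ℤ) • a₁ := by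
    rw [hR', ← map_zsmul, ← ofMul_zpow, zpow_natCast, hwp, hu'val, hpa₁]
  set T : localPoints W' (v.adicCompletion K) := a₁ - R' with hT
  have hTp : (p : ℤ) • T = 0 := by rw [hT, zsmul_sub, hR'p, sub_self]
  set Tt : AddSubgroup.torsionBy (localPoints W' (v.adicCompletion K)) (p : ℤ) :=
    ⟨T, (Submodule.mem_torsionBy_iff _ _).mpr hTp⟩ with hTt
  set T₀ : geomTorsion W' (p : ℤ) := e'.symm Tt with hT₀
  have hT₀ : pointsMap W' (v.adicCompletion K) (T₀ : geomPoints W') = T := by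
    rw [hT₀, he', W'.pointsMap_torsionPointsEquiv_symm (p : ℤ) hn Tt]
  -- `ζ_σ`, defined by `(σw)^{ε σ} = ζ_σ w`, is a `p`-th root of unity (`u'` is invariant)
  obtain ⟨ζf, hζf⟩ : ∃ ζf : (absoluteGaloisGroup (v.adicCompletion K)) → (AlgebraicClosure
      (v.adicCompletion K))ˣ, ∀ σ, (Units.map
      (absoluteGaloisGroup.toAlgEquiv _ σ : AlgebraicClosure (v.adicCompletion K)
      →* AlgebraicClosure (v.adicCompletion K)) w) ^ (ε σ) = ζf σ * w :=
    ⟨fun σ ↦ (Units.map (absoluteGaloisGroup.toAlgEquiv _ σ : AlgebraicClosure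
        (v.adicCompletion K) →* AlgebraicClosure (v.adicCompletion K)) w) ^ (ε σ) / w,
        fun σ ↦ by rw [div_mul_cancel]⟩
  have hζσ : ∀ σ : (absoluteGaloisGroup (v.adicCompletion K)), (ζf σ) ^ p = 1 := by
    intro σ
    have h : ((Units.map (absoluteGaloisGroup.toAlgEquiv _ σ : AlgebraicClosure
        (v.adicCompletion K) →* AlgebraicClosure (v.adicCompletion K)) w) ^ (ε σ)) ^ p =
        (ζf σ * w) ^ p := by
      rw [hζf σ]
    rw [← hact_pow, hwp, hu'inv σ, mul_pow, hwp] at h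
    exact (mul_right_cancel (by rw [one_mul]; exact h.symm)).symm.symm
  -- the cocycle of `E'`: `φ(σ) = e'⁻¹ Φ'(ζ_σ) + (σ T₀ - T₀)`
  have hφσ : ∀ σ : (absoluteGaloisGroup (v.adicCompletion K)), φ.1 (resGal (K := K)
      (v.adicCompletion K) σ) =
      e'.symm ⟨Φ' (Additive.ofMul (ζf σ)), hmem' (hζσ σ)⟩ + (resGal (K := K)
          (v.adicCompletion K) σ • T₀ - T₀) := by
    intro σ
    apply Subtype.ext
    apply pointsMapOfEmb_injective W' (closureEmb (K := K) (v.adicCompletion K))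
    change pointsMap W' (v.adicCompletion K) _ = pointsMap W' (v.adicCompletion K) _
    rw [ha₁' σ, AddSubgroup.coe_add, AddSubgroup.coe_sub, map_add (pointsMap W'
        (v.adicCompletion K)),
      map_sub (pointsMap W' (v.adicCompletion K)),
      Literature.NumberTheory.EllipticCurves.AddSubgroup.torsionBy.coe_smul, pointsMap_smul, hT₀,
      he', W'.pointsMap_torsionPointsEquiv_symm (p : ℤ) hn]
    change σ • a₁ - a₁ = Φ' (Additive.ofMul (ζf σ)) + (σ • T - T)
    rw [hT, smul_sub, hR', hequiv' σ w, hζf σ, ofMul_mul, map_add Φ']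
    abel
  -- the witness for `E`: `b = Φ(w^a) + θ T₀`
  rw [h1Equiv_oneCocycleClass, selmerLocalKer, oneCocycleClass_mem_resKer_iff]
  refine ⟨Φ (Additive.ofMul (w ^ a)) +
    pointsMap W (v.adicCompletion K) ((θ T₀ : geomTorsion W (p : ℤ)) : geomPoints W), fun σ ↦ ?_⟩
  change pointsMap W (v.adicCompletion K) ((θ (φ.1 (resGal (K := K)
      (v.adicCompletion K) σ)) : geomTorsion W (p : ℤ)) :
    geomPoints W) = _
  have hwa : (Units.map (absoluteGaloisGroup.toAlgEquiv _ σ : AlgebraicClosure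
      (v.adicCompletion K) →* AlgebraicClosure (v.adicCompletion K)) (w ^ a)) ^ (ε σ) =
      (ζf σ) ^ a * w ^ a := by
    rw [hact_pow, hζf σ, mul_pow]
  rw [hφσ σ, map_add θ, map_sub θ, AddSubgroup.coe_add, AddSubgroup.coe_sub,
    map_add (pointsMap W (v.adicCompletion K)), map_sub (pointsMap W (v.adicCompletion K)),
        ← hG_apply, hclaim _ (hζσ σ), hθ,
    Literature.NumberTheory.EllipticCurves.AddSubgroup.torsionBy.coe_smul, pointsMap_smul,
    smul_add σ (Φ (Additive.ofMul (w ^ a))), hequiv σ (w ^ a), hwa, ofMul_mul, map_add Φ]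
  abel

end TwistedKummer

end Summit.BirchSwinnertonDyer.Rank1Residual.GaloisImage

end
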